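import Mathlib
import HarnessLib

/-!
# Route `ForcedResponseSkewness`, crux `ResponseLocalisation` (contact half): the INSTRUMENT outcome, typed —
# in the RG-improved one-loop model the integrated dens×dens→dens contact coefficient up to cut `δ` is `ḡ²(δ)/2`

Tribunal J round 1 on route `ForcedResponseSkewness` (feedback (ii)/(iv), critic P2) asked for the CHEAPEST FALSIFIER of the deciding
crux before research provers sit on `stub_contact`: does the integrated contact coefficient of the third action-density insertion at
physical cut `δ` resum to the running coupling AT SCALE `δ` (→ 0: the response is localisable on a disjoint source, as the crux claims)
or stay at the coupling of the pair's own scale (non-localisable: crux false as typed)?  Inputs (lead's note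
`INSTRUMENT-contact-coefficient.md`, evidence on stmt-QuantumFields-24293): lattice contact term `κ_c = g₀²/2` per puncture (tree-level
sum rule; card `Cruxes/NT/Ideas/skewness-from-asymptotic-freedom.md` K1(a), print-checked), separated one-loop OPE coefficient
`(b₀/2π²)ḡ⁴(u)/|u|⁴` whose TREE-LEVEL part vanishes identically (tree theorem `SelfNormalisedSkewness.Negative.maxwellOddRing_eq_zero`),
one-loop running `dḡ²/dlog u = 2b₀ḡ⁴`.  This file types the resulting MODEL identity and its consequence:

* `gbarSq b₀ g₀² t = g₀²/(1 − 2b₀g₀²t)` — the one-loop running coupling at log-scale `t = log(u/a)`; `hasDerivAt_gbarSq` — the one-loop ODE;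
* `integrated_contact_coefficient` — `g₀²/2 + b₀ ∫₀ᵀ ḡ⁴ dt = ḡ²(T)/2`: lattice contact + resummed shell = HALF THE RUNNING COUPLING AT THE CUT
  (the bare coupling cancels, as RG invariance demands);
* `contactShare`, `tendsto_contactShare_zero` — in continuum form `ḡ²(u) = 1/(2b₀ log(1/(uΛ)))` the share `ḡ²(δ)/ḡ²(r) =
  log(1/(rΛ))/log(1/(δΛ))` of the response carried within distance `δ` of the punctures tends to `0` as `δ → 0⁺` (logarithmically:
  `δ = exp(−O(1/η))`, the price printed in the route's why-might-fail).

Outcome: FAVOURABLE — the falsifier does not fire in the model; the abelian case `b₀ = 0` gives `ḡ ≡ g₀`, share pinned (pure lattice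
contact), consistent with barrier `AbelianDeconfinementD4`.  Honest label: folklore calculus about MODEL functions (a decided toy analogue of
the contact crux, BC5/T3 material); it proves nothing about the lattice Yang–Mills cumulants, the crux, NT (rung R2a) or the YM mass gap.
Refs: Montvay–Münster (1994) §3.4 (running coupling); Harnett–Steele, arXiv:hep-ph/0410388 p.4 (scalar-gluonium OPE coefficient).
-/

set_option autoImplicit false

noncomputable section

namespace Summit.QuantumFields.YangMills.Theorems.ForcedResponseSkewness.ContactOneLoop

open MeasureTheory Filter Topology Set

/-- The one-loop running coupling squared at log-scale `t = log(u/a)` from the bare value `g₀²`: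
`ḡ²(t) = g₀² / (1 − 2 b₀ g₀² t)` (valid below the Landau pole `2b₀g₀²t < 1`). [folklore] -/
def gbarSq (b₀ g₀sq t : ℝ) : ℝ := g₀sq / (1 - 2 * b₀ * g₀sq * t)

/-- At the lattice scale (`t = 0`) the running coupling is the bare one. [folklore] -/
@[simp] theorem gbarSq_zero (b₀ g₀sq : ℝ) : gbarSq b₀ g₀sq 0 = g₀sq := by simp [gbarSq]

/-- **One-loop RG equation** `dḡ²/dt = 2 b₀ ḡ⁴` away from the Landau pole. [folklore] -/
theorem hasDerivAt_gbarSq (b₀ g₀sq t : ℝ) (h : 1 - 2 * b₀ * g₀sq * t ≠ 0) :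
    HasDerivAt (gbarSq b₀ g₀sq) (2 * b₀ * gbarSq b₀ g₀sq t ^ 2) t := by
  have hden : HasDerivAt (fun s : ℝ => 1 - 2 * b₀ * g₀sq * s) (-(2 * b₀ * g₀sq)) t := by
    simpa using ((hasDerivAt_id t).const_mul (2 * b₀ * g₀sq)).const_sub 1
  have h1 := (hasDerivAt_const t g₀sq).div hden h
  have e : (0 * (1 - 2 * b₀ * g₀sq * t) - g₀sq * -(2 * b₀ * g₀sq)) / (1 - 2 * b₀ * g₀sq * t) ^ 2 =
      2 * b₀ * gbarSq b₀ g₀sq t ^ 2 := by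
    rw [gbarSq, div_pow]
    field_simp
    ring
  rw [← e]
  exact h1

/-- **The integrated contact coefficient (RG-improved one loop).**  Below the Landau pole, the lattice contact term `g₀²/2`
plus the resummed shell `b₀ ∫₀ᵀ ḡ⁴(t) dt` (the separated one-loop coefficient `(b₀/2π²)ḡ⁴(u)/|u|⁴` integrated over
`a < |u| < a e^T`, angular factor `2π²`) equals `ḡ²(T)/2`: HALF THE RUNNING COUPLING AT THE CUT — the bare coupling cancels.
(`0 ≤ b₀ g₀²` keeps `[0, T]` below the pole.) [folklore] -/
theorem integrated_contact_coefficient (b₀ g₀sq T : ℝ) (hbg : 0 ≤ b₀ * g₀sq) (hT : 0 ≤ T)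
    (hpole : 2 * b₀ * g₀sq * T < 1) :
    g₀sq / 2 + b₀ * ∫ t in (0 : ℝ)..T, gbarSq b₀ g₀sq t ^ 2 = gbarSq b₀ g₀sq T / 2 := by
  -- denominators stay positive on `[0, T]`
  have hden : ∀ t ∈ Set.uIcc (0 : ℝ) T, 1 - 2 * b₀ * g₀sq * t ≠ 0 := by
    intro t ht
    rw [Set.uIcc_of_le hT] at ht
    have : 2 * b₀ * g₀sq * t ≤ 2 * b₀ * g₀sq * T := by
      have := mul_le_mul_of_nonneg_left ht.2 (by linarith : (0 : ℝ) ≤ 2 * (b₀ * g₀sq))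
      linarith [this]
    linarith
  -- FTC for `ḡ²/2`, whose derivative is `b₀ ḡ⁴`
  have hderiv : ∀ t ∈ Set.uIcc (0 : ℝ) T,
      HasDerivAt (fun s => gbarSq b₀ g₀sq s / 2) (b₀ * gbarSq b₀ g₀sq t ^ 2) t := by
    intro t ht
    have h := (hasDerivAt_gbarSq b₀ g₀sq t (hden t ht)).div_const 2
    have e : 2 * b₀ * gbarSq b₀ g₀sq t ^ 2 / 2 = b₀ * gbarSq b₀ g₀sq t ^ 2 := by ring
    rw [e] at h
    exact h
  have hcont : ContinuousOn (fun t => b₀ * gbarSq b₀ g₀sq t ^ 2) (Set.uIcc (0 : ℝ) T) := by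
    have hc : ContinuousOn (gbarSq b₀ g₀sq) (Set.uIcc (0 : ℝ) T) := by
      intro t ht
      have hd : ContinuousAt (fun s : ℝ => 1 - 2 * b₀ * g₀sq * s) t := by fun_prop
      exact ((continuousAt_const.div hd (hden t ht)).continuousWithinAt : _)
    exact (continuousOn_const.mul (hc.pow 2))
  have hint : IntervalIntegrable (fun t => b₀ * gbarSq b₀ g₀sq t ^ 2) volume 0 T :=
    hcont.intervalIntegrable
  have hftc := intervalIntegral.integral_eq_sub_of_hasDerivAt hderiv hint
  simp only [gbarSq_zero, intervalIntegral.integral_const_mul] at hftc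
  linarith

/-- The continuum one-loop running coupling at distance `u` (dimensional transmutation scale `Λ`):
`ḡ²(u) = 1/(2 b₀ log(1/(uΛ)))`, `uΛ < 1`. [folklore] -/
def gbarSqCont (b₀ Λ u : ℝ) : ℝ := 1 / (2 * b₀ * Real.log (1 / (u * Λ)))

/-- The model's CONTACT SHARE of the coupling response of a pair at separation `r` carried within distance `δ` of the two
punctures: `ḡ²(δ)/ḡ²(r)` (both punctures contribute `ḡ²(δ)/2`, the whole response is `ḡ²(r)` = the sum rule saturated at `δ = r`). [folklore] -/
def contactShare (b₀ Λ r δ : ℝ) : ℝ := gbarSqCont b₀ Λ δ / gbarSqCont b₀ Λ r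

/-- In closed form the share is a ratio of logarithms, `log(1/(rΛ)) / log(1/(δΛ))` (for `b₀ ≠ 0`; Lean's `x/0 = 0` covers the pole). [folklore] -/
theorem contactShare_eq (b₀ Λ r δ : ℝ) (hb : b₀ ≠ 0) :
    contactShare b₀ Λ r δ = Real.log (1 / (r * Λ)) / Real.log (1 / (δ * Λ)) := by
  have h2 : (2 : ℝ) * b₀ ≠ 0 := mul_ne_zero two_ne_zero hb
  by_cases hδ : Real.log (1 / (δ * Λ)) = 0
  · rw [contactShare, gbarSqCont, gbarSqCont, hδ]; simp
  · rw [contactShare, gbarSqCont, gbarSqCont]; field_simp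

/-- **The falsifier does not fire (model):** the contact share tends to `0` as the cut `δ → 0⁺` — logarithmically, so that
tolerance `η` needs `δ ≤ Λ⁻¹ (rΛ)^{1/η}`, i.e. `δ = exp(−O(1/η))` (the price printed in the route's why-might-fail).  For `b₀ = 0`
(abelian) `gbarSqCont` degenerates and there is no decay: the response is pure lattice contact. [folklore] -/
theorem tendsto_contactShare_zero (b₀ Λ r : ℝ) (hb : b₀ ≠ 0) (hΛ : 0 < Λ) :
    Tendsto (fun δ => contactShare b₀ Λ r δ) (nhdsWithin 0 (Set.Ioi 0)) (nhds 0) := by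
  have hlog : Tendsto (fun δ : ℝ => Real.log (1 / (δ * Λ))) (nhdsWithin 0 (Set.Ioi 0)) atTop := by
    have h1 : Tendsto (fun δ : ℝ => δ * Λ) (nhdsWithin 0 (Set.Ioi 0)) (nhdsWithin 0 (Set.Ioi 0)) := by
      refine tendsto_nhdsWithin_iff.2 ⟨?_, ?_⟩
      · have : Tendsto (fun δ : ℝ => δ * Λ) (nhds 0) (nhds (0 * Λ)) := tendsto_id.mul_const Λ
        rw [zero_mul] at this
        exact this.mono_left nhdsWithin_le_nhds
      · filter_upwards [self_mem_nhdsWithin] with δ hδ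
        exact mul_pos hδ hΛ
    have h2 : Tendsto (fun x : ℝ => 1 / x) (nhdsWithin 0 (Set.Ioi 0)) atTop := by
      simpa only [one_div] using tendsto_inv_nhdsGT_zero
    exact Real.tendsto_log_atTop.comp (h2.comp h1)
  have h := hlog.inv_tendsto_atTop.const_mul (Real.log (1 / (r * Λ)))
  rw [mul_zero] at h
  refine (h.congr' ?_)
  filter_upwards [self_mem_nhdsWithin] with δ _hδ
  rw [contactShare_eq b₀ Λ r δ hb]
  exact (div_eq_mul_inv _ _).symm

end Summit.QuantumFields.YangMills.Theorems.ForcedResponseSkewness.ContactOneLoop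

end
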